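import Summits.AtomisticToContinuum.BoseEinsteinCondensation.Theorems.BECCutLineWeakDisorderTaggedShiftGhostRepresentation
import Summits.AtomisticToContinuum.BoseEinsteinCondensation.Theorems.BECCutLineWeakDisorderTwoReplicaTransienceBoundFactorisation
import Literature.MathematicalPhysics.QuantumManyBody.GroundStateFeynmanKacCutLine
import HarnessLib

/-!
# Route `BECCutLineWeakDisorder`, crux `TwoReplicaTransienceBound` (stmt-AtomisticToContinuum-9687),
# line `tagged-shift-log-harnack`: the phantom factorisation of the ghost weight
# (second half of the phantom identity (★))

Support file (lead a1). The raw Feynman–Kac weight of the GHOST sample (tagged Brownian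
coordinates shifted by the ramps `u ↦ a_k min(u, τ₀)`, `stub_ghostRepresentation`) over the window
`[0, τ₀ + t]` factorises as

  (ghost tagged window factor on `[0, τ₀]`) × (bath window factor on `[0, τ₀]`) × (full weight on `[τ₀, τ₀ + t]`
  of the REAL system started at the shifted start `X' = X + √2 τ₀ a e₀`),

the last two factors forming the PHANTOM weight `phantomWeight v L τ₀ t X'` (the tagged particle is
a phantom during the window: neither killed nor interacting). At `a = 0` this is
`fkWeight = taggedWindowFactor × phantomWeight`, whence `φ_T ≤ φ̄ := ∫ phantomWeight`.

* `ghostHead`, `ghostConfig`, `shiftedStart`, `rawWorldLine_taggedRampShift` — the ghost world-line;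
* `taggedWindowFactor`, `bathWindowFactor`, `postFactor`, `phantomWeight`;
* `rawFKWeight_taggedRampShift_eq` — the factorisation (registered toolbox stub `stub_phantomFactorisation`);
* `fkWeight_eq_taggedWindowFactor_mul_phantomWeight` (`a = 0`), `fkSemigroup_one_le_phantom`.

References: B. Simon, *Functional Integration and Quantum Physics* (1979) §V; Chung–Zhao (1995) §3.2.
[folklore]
-/

noncomputable section

open MeasureTheory Filter Set Finset
open scoped ENNReal NNReal Topology BigOperators

namespace Summit.AtomisticToContinuum.BoseEinsteinCondensation.Cruxes.TwoReplicaTransienceBound.TaggedShiftLogHarnack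

open Literature.MathematicalPhysics.QuantumManyBody.BoseGas
open Literature.Probability.Process
open Summit.AtomisticToContinuum.BoseEinsteinCondensation.Cruxes.TwoReplicaTransienceBound.TracerDecoupling.TracerFactorisation

variable {n : ℕ}

/-! ### Generic time splitting -/

/-- Splitting a "for all times in `[0, s + t]`" condition at `s`. [folklore] -/
theorem forall_mem_Icc_add_iff {P : ℝ≥0 → Prop} (s t : ℝ≥0) :
    (∀ r ∈ Set.Icc (0 : ℝ) ((s : ℝ) + t), P r.toNNReal) ↔
      (∀ r ∈ Set.Icc (0 : ℝ) (s : ℝ), P r.toNNReal) ∧ ∀ r ∈ Set.Icc (0 : ℝ) (t : ℝ), P (s + r.toNNReal) := by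
  constructor
  · intro h
    refine ⟨fun r hr => h r ⟨hr.1, hr.2.trans (by simp)⟩, fun r hr => ?_⟩
    have := h (s + r) ⟨add_nonneg s.coe_nonneg hr.1, by linarith [hr.2]⟩
    rwa [toNNReal_coe_add hr.1] at this
  · rintro ⟨h1, h2⟩ r hr
    rcases le_or_gt r s with hrs | hrs
    · exact h1 r ⟨hr.1, hrs⟩
    · have h := h2 (r - s) ⟨by linarith, by linarith [hr.2]⟩
      have e : (s : ℝ) + (r - s) = r := by ring
      rwa [← toNNReal_coe_add (by linarith), e] at h

/-- Splitting a time integral over `(0, s + t]` at `s`: `∫₀^{s+t} f = ∫₀ˢ f + ∫₀ᵗ f(s + ·)`.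
[folklore] -/
theorem lintegral_Ioc_add_eq (f : ℝ≥0 → ℝ≥0∞) (s t : ℝ≥0) :
    ∫⁻ r in Set.Ioc (0 : ℝ) ((s : ℝ) + t), f r.toNNReal =
      (∫⁻ r in Set.Ioc (0 : ℝ) (s : ℝ), f r.toNNReal) + ∫⁻ r in Set.Ioc (0 : ℝ) (t : ℝ), f (s + r.toNNReal) := by
  rw [← Set.Ioc_union_Ioc_eq_Ioc (a := (0 : ℝ)) (b := (s : ℝ)) s.coe_nonneg (by simp),
    lintegral_union measurableSet_Ioc (Set.Ioc_disjoint_Ioc.2 (by simp))]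
  congr 1
  rw [← lintegral_indicator measurableSet_Ioc, ← lintegral_indicator measurableSet_Ioc,
    ← lintegral_add_right_eq_self (μ := (volume : Measure ℝ)) _ (s : ℝ)]
  refine lintegral_congr fun r => ?_
  by_cases hr : r ∈ Set.Ioc (0 : ℝ) t
  · have hr' : r + s ∈ Set.Ioc (s : ℝ) (s + t) := ⟨by linarith [hr.1], by linarith [hr.2]⟩
    rw [Set.indicator_of_mem hr', Set.indicator_of_mem hr, add_comm r s, toNNReal_coe_add hr.1.le]
  · have hr' : r + s ∉ Set.Ioc (s : ℝ) (s + t) := fun h => hr ⟨by linarith [h.1], by linarith [h.2]⟩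
    rw [Set.indicator_of_notMem hr', Set.indicator_of_notMem hr]

/-! ### The ghost world-line -/

/-- The GHOST position of the tagged particle at time `r`: the real tagged position plus
`√2 a · min(r, τ₀)` (a ramp ending at the constant displacement `√2 τ₀ a`). -/
def ghostHead (X : Config (n + 1)) (a : Fin 3 → ℝ) (τ₀ : ℝ≥0) (ω : PathSpace (n + 1)) (r : ℝ≥0) : Space :=
  worldLine X ω r 0 + WithLp.toLp 2 (fun k : Fin 3 => Real.sqrt 2 * (a k * ((min r τ₀ : ℝ≥0) : ℝ)))

/-- The ghost configuration: tagged particle at the ghost position, bath lines real. -/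
def ghostConfig (X : Config (n + 1)) (a : Fin 3 → ℝ) (τ₀ : ℝ≥0) (ω : PathSpace (n + 1)) (r : ℝ≥0) :
    Config (n + 1) :=
  Function.update (worldLine X ω r) 0 (ghostHead X a τ₀ ω r)

/-- The shifted start `X' = X + √2 τ₀ a e₀`: after the window the ghost world-line is the real
world-line started at `X'`. -/
def shiftedStart (X : Config (n + 1)) (a : Fin 3 → ℝ) (τ₀ : ℝ≥0) : Config (n + 1) :=
  Function.update X 0 (X 0 + WithLp.toLp 2 (fun k : Fin 3 => Real.sqrt 2 * (a k * (τ₀ : ℝ))))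

/-- The ramp-shifted Brownian paths are continuous. [folklore] -/
theorem continuous_taggedRampShift_brownianPaths (a : Fin 3 → ℝ) (τ₀ : ℝ≥0) (ω : PathSpace (n + 1))
    (i : Fin (n + 1)) (k : Fin 3) : Continuous (taggedRampShift a τ₀ (brownianPaths ω) i k) := by
  unfold taggedRampShift brownianPaths
  refine (continuous_brownian _).add ?_
  split_ifs
  · exact continuous_const.mul (NNReal.continuous_coe.comp (continuous_id.min continuous_const))
  · exact continuous_const

/-- **The raw world-line of the ghost sample is the ghost configuration.** [folklore] -/
theorem rawWorldLine_taggedRampShift (X : Config (n + 1)) (a : Fin 3 → ℝ) (τ₀ : ℝ≥0)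
    (ω : PathSpace (n + 1)) (r : ℝ≥0) :
    rawWorldLine (X, taggedRampShift a τ₀ (brownianPaths ω)) r = ghostConfig X a τ₀ ω r := by
  have hc := continuous_taggedRampShift_brownianPaths a τ₀ ω
  have h := raw_worldLine_of_continuous X (w := taggedRampShift a τ₀ (brownianPaths ω)) hc r
  unfold rawWorldLine
  rw [h]
  funext i
  by_cases hi : i = 0
  · subst hi
    simp only [ghostConfig, Function.update_self, ghostHead, worldLine, taggedRampShift,
      brownianPaths, if_true]
    rw [add_assoc]
    congr 1
    rw [← WithLp.toLp_add]
    congr 1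
    funext k
    simp only [Pi.add_apply]
    ring
  · simp [ghostConfig, worldLine, taggedRampShift, brownianPaths, hi]

/-- The ghost's tagged coordinate. [folklore] -/
@[simp] theorem ghostConfig_zero (X : Config (n + 1)) (a : Fin 3 → ℝ) (τ₀ : ℝ≥0) (ω : PathSpace (n + 1))
    (r : ℝ≥0) : ghostConfig X a τ₀ ω r 0 = ghostHead X a τ₀ ω r := by
  simp [ghostConfig]

/-- The ghost's bath coordinates are the real ones. [folklore] -/
@[simp] theorem ghostConfig_succ (X : Config (n + 1)) (a : Fin 3 → ℝ) (τ₀ : ℝ≥0) (ω : PathSpace (n + 1))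
    (r : ℝ≥0) (j : Fin n) : ghostConfig X a τ₀ ω r j.succ = worldLine X ω r j.succ := by
  simp [ghostConfig]

/-- The bath coordinates do not see the shift of the start. [folklore] -/
@[simp] theorem worldLine_shiftedStart_succ (X : Config (n + 1)) (a : Fin 3 → ℝ) (τ₀ : ℝ≥0)
    (ω : PathSpace (n + 1)) (r : ℝ≥0) (j : Fin n) :
    worldLine (shiftedStart X a τ₀) ω r j.succ = worldLine X ω r j.succ := by
  simp [worldLine, shiftedStart]

/-- After the window the ghost is the real world-line from the shifted start. [folklore] -/
theorem ghostConfig_add (X : Config (n + 1)) (a : Fin 3 → ℝ) (τ₀ : ℝ≥0) (ω : PathSpace (n + 1))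
    (r : ℝ≥0) : ghostConfig X a τ₀ ω (τ₀ + r) = worldLine (shiftedStart X a τ₀) ω (τ₀ + r) := by
  funext i
  by_cases hi : i = 0
  · subst hi
    have hmin : min (τ₀ + r) τ₀ = τ₀ := min_eq_right le_self_add
    simp only [ghostConfig_zero, ghostHead, worldLine, shiftedStart, Function.update_self, hmin]
    rw [add_right_comm]
  · obtain ⟨j, rfl⟩ := Fin.exists_succ_eq.2 hi
    rw [ghostConfig_succ, worldLine_shiftedStart_succ]

/-! ### The factors -/

/-- **Tagged window factor of the ghost**: survival of the ghost's tagged line in the box during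
`[0, τ₀]` times `e^{-(ghost-tagged ↔ bath dose on [0, τ₀])}` (the functional `ℛ`-weighted in (★);
at `a = 0` it is the REAL tagged line's window legality × dose, `L` of LeadA1Report §2). -/
def taggedWindowFactor (v : ℝ → ℝ≥0∞) (L : ℝ) (X : Config (n + 1)) (a : Fin 3 → ℝ) (τ₀ : ℝ≥0)
    (ω : PathSpace (n + 1)) : ℝ≥0∞ :=
  {ω' : PathSpace (n + 1) | ∀ r ∈ Set.Icc (0 : ℝ) (τ₀ : ℝ), ghostHead X a τ₀ ω' r.toNNReal ∈ box L}.indicator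
    (fun ω' => expNeg (∫⁻ r in Set.Ioc (0 : ℝ) (τ₀ : ℝ),
      ∑ j : Fin n, v (dist (ghostHead X a τ₀ ω' r.toNNReal) (worldLine X ω' r.toNNReal j.succ)))) ω

/-- **Bath window factor**: survival and self-interaction weight of the bath lines during
`[0, τ₀]` (the tagged particle being a phantom). -/
def bathWindowFactor (v : ℝ → ℝ≥0∞) (L : ℝ) (X : Config (n + 1)) (τ₀ : ℝ≥0) (ω : PathSpace (n + 1)) :
    ℝ≥0∞ :=
  {ω' : PathSpace (n + 1) | ∀ r ∈ Set.Icc (0 : ℝ) (τ₀ : ℝ), ∀ j : Fin n,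
      worldLine X ω' r.toNNReal j.succ ∈ box L}.indicator
    (fun ω' => expNeg (∫⁻ r in Set.Ioc (0 : ℝ) (τ₀ : ℝ),
      interaction v (fun j : Fin n => worldLine X ω' r.toNNReal j.succ))) ω

/-- **Post-window factor**: the full weight of the system read from time `τ₀` on, during `[0, t]`
(verbatim the second factor of `fkWeight_add_eq_mul`). -/
def postFactor (v : ℝ → ℝ≥0∞) (L : ℝ) (X : Config (n + 1)) (τ₀ t : ℝ≥0) (ω : PathSpace (n + 1)) : ℝ≥0∞ :=
  {ω' : PathSpace (n + 1) | ∀ r ∈ Set.Icc (0 : ℝ) (t : ℝ),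
      worldLine X ω' (τ₀ + r.toNNReal) ∈ boxN (n + 1) L}.indicator
    (fun ω' => expNeg (∫⁻ r in Set.Ioc (0 : ℝ) (t : ℝ), interaction v (worldLine X ω' (τ₀ + r.toNNReal)))) ω

/-- **Phantom weight** over `[0, τ₀ + t]` from the start `X`: bath window factor × post-window full
weight — the tagged particle is a phantom on `[0, τ₀]` and real afterwards. Its integral
`φ̄(X) = ∫ phantomWeight dW ≥ (e^{-(τ₀+t)H}1)(X)` is the phantom partition function of (★). -/
def phantomWeight (v : ℝ → ℝ≥0∞) (L : ℝ) (τ₀ t : ℝ≥0) (X : Config (n + 1)) (ω : PathSpace (n + 1)) : ℝ≥0∞ :=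
  bathWindowFactor v L X τ₀ ω * postFactor v L X τ₀ t ω

/-- The bath window factor does not see the shift of the start. [folklore] -/
theorem bathWindowFactor_shiftedStart (v : ℝ → ℝ≥0∞) (L : ℝ) (X : Config (n + 1)) (a : Fin 3 → ℝ)
    (τ₀ : ℝ≥0) (ω : PathSpace (n + 1)) :
    bathWindowFactor v L (shiftedStart X a τ₀) τ₀ ω = bathWindowFactor v L X τ₀ ω := by
  simp only [bathWindowFactor, worldLine_shiftedStart_succ]

/-! ### The factorisation -/

/-- The ghost position, read at real times, is continuous. [folklore] -/
theorem continuous_ghostHead_toNNReal (X : Config (n + 1)) (a : Fin 3 → ℝ) (τ₀ : ℝ≥0)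
    (ω : PathSpace (n + 1)) : Continuous fun r : ℝ => ghostHead X a τ₀ ω r.toNNReal := by
  unfold ghostHead
  refine ((continuous_apply 0).comp (continuous_worldLine_toNNReal X ω)).add ?_
  refine (PiLp.continuous_toLp 2 _).comp (continuous_pi fun k => ?_)
  exact continuous_const.mul (continuous_const.mul
    (NNReal.continuous_coe.comp (continuous_real_toNNReal.min continuous_const)))

/-- The ghost-tagged ↔ bath dose rate is measurable in time. [folklore] -/
theorem measurable_ghostDoseRate {v : ℝ → ℝ≥0∞} (hv : Measurable v) (X : Config (n + 1))
    (a : Fin 3 → ℝ) (τ₀ : ℝ≥0) (ω : PathSpace (n + 1)) :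
    Measurable fun r : ℝ => ∑ j : Fin n,
      v (dist (ghostHead X a τ₀ ω r.toNNReal) (worldLine X ω r.toNNReal j.succ)) := by
  refine Finset.measurable_sum _ fun j _ => hv.comp ?_
  exact ((continuous_ghostHead_toNNReal X a τ₀ ω).dist
    ((continuous_apply j.succ).comp (continuous_worldLine_toNNReal X ω))).measurable

/-- The ghost configuration is in the box iff its tagged ghost and the bath lines are. [folklore] -/
theorem ghostConfig_mem_boxN_iff (L : ℝ) (X : Config (n + 1)) (a : Fin 3 → ℝ) (τ₀ : ℝ≥0)
    (ω : PathSpace (n + 1)) (r : ℝ≥0) :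
    ghostConfig X a τ₀ ω r ∈ boxN (n + 1) L ↔
      ghostHead X a τ₀ ω r ∈ box L ∧ ∀ j : Fin n, worldLine X ω r j.succ ∈ box L := by
  simp only [boxN, Set.mem_setOf_eq, Fin.forall_fin_succ, ghostConfig_zero, ghostConfig_succ]

/-- The interaction of the ghost configuration: ghost-tagged ↔ bath pairs plus the bath's own.
[folklore] -/
theorem interaction_ghostConfig (v : ℝ → ℝ≥0∞) (X : Config (n + 1)) (a : Fin 3 → ℝ) (τ₀ : ℝ≥0)
    (ω : PathSpace (n + 1)) (r : ℝ≥0) :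
    interaction v (ghostConfig X a τ₀ ω r) =
      (∑ j : Fin n, v (dist (ghostHead X a τ₀ ω r) (worldLine X ω r j.succ))) +
        interaction v (fun j : Fin n => worldLine X ω r j.succ) := by
  rw [interaction_succ]
  simp only [ghostConfig_zero, ghostConfig_succ]

/-- **Phantom factorisation of the ghost weight** (registered toolbox stub `stub_phantomFactorisation`
is its `∀`-closed form): over the window `[0, τ₀ + t]`, the raw Feynman–Kac weight of the ghost
sample equals (ghost tagged window factor) × (phantom weight from the shifted start). Time split at
`τ₀` (`forall_mem_Icc_add_iff`, `lintegral_Ioc_add_eq`), particle split of the window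
(`ghostConfig_mem_boxN_iff`, `interaction_ghostConfig`), and `ghostConfig_add` for the post-window
part. [folklore] -/
theorem rawFKWeight_taggedRampShift_eq {v : ℝ → ℝ≥0∞} (hv : Measurable v) (L : ℝ) (X : Config (n + 1))
    (a : Fin 3 → ℝ) (τ₀ t : ℝ≥0) (ω : PathSpace (n + 1)) :
    rawFKWeight v L ((τ₀ : ℝ) + t) (X, taggedRampShift a τ₀ (brownianPaths ω)) =
      taggedWindowFactor v L X a τ₀ ω * phantomWeight v L τ₀ t (shiftedStart X a τ₀) ω := by
  set X' := shiftedStart X a τ₀ with hX'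
  -- the three survival conditions and the three actions
  set A : Prop := ∀ r ∈ Set.Icc (0 : ℝ) (τ₀ : ℝ), ghostHead X a τ₀ ω r.toNNReal ∈ box L with hA
  set B : Prop := ∀ r ∈ Set.Icc (0 : ℝ) (τ₀ : ℝ), ∀ j : Fin n, worldLine X ω r.toNNReal j.succ ∈ box L
    with hB
  set C : Prop := ∀ r ∈ Set.Icc (0 : ℝ) (t : ℝ), worldLine X' ω (τ₀ + r.toNNReal) ∈ boxN (n + 1) L with hC
  set I₁ : ℝ≥0∞ := ∫⁻ r in Set.Ioc (0 : ℝ) (τ₀ : ℝ),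
    ∑ j : Fin n, v (dist (ghostHead X a τ₀ ω r.toNNReal) (worldLine X ω r.toNNReal j.succ)) with hI₁
  set I₂ : ℝ≥0∞ := ∫⁻ r in Set.Ioc (0 : ℝ) (τ₀ : ℝ),
    interaction v (fun j : Fin n => worldLine X ω r.toNNReal j.succ) with hI₂
  set I₃ : ℝ≥0∞ := ∫⁻ r in Set.Ioc (0 : ℝ) (t : ℝ), interaction v (worldLine X' ω (τ₀ + r.toNNReal)) with hI₃
  -- survival of the ghost sample ↔ A ∧ B ∧ C
  have hsurv : (X, taggedRampShift a τ₀ (brownianPaths ω)) ∈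
      {q : Config (n + 1) × PathSpace (n + 1) | ∀ r ∈ Set.Icc (0 : ℝ) ((τ₀ : ℝ) + t),
        rawWorldLine q r.toNNReal ∈ boxN (n + 1) L} ↔ A ∧ (B ∧ C) := by
    simp only [Set.mem_setOf_eq, rawWorldLine_taggedRampShift]
    rw [forall_mem_Icc_add_iff (P := fun r => ghostConfig X a τ₀ ω r ∈ boxN (n + 1) L) τ₀ t]
    simp only [ghostConfig_mem_boxN_iff, ghostConfig_add]
    constructor
    · rintro ⟨h1, h2⟩
      exact ⟨fun r hr => (h1 r hr).1, fun r hr => (h1 r hr).2, h2⟩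
    · rintro ⟨h1, h2, h3⟩
      exact ⟨fun r hr => ⟨h1 r hr, h2 r hr⟩, h3⟩
  -- the action of the ghost sample = I₁ + I₂ + I₃
  have hact : (∫⁻ r in Set.Ioc (0 : ℝ) ((τ₀ : ℝ) + t),
      interaction v (rawWorldLine (X, taggedRampShift a τ₀ (brownianPaths ω)) r.toNNReal)) =
        I₁ + I₂ + I₃ := by
    simp only [rawWorldLine_taggedRampShift]
    rw [lintegral_Ioc_add_eq (fun r => interaction v (ghostConfig X a τ₀ ω r)) τ₀ t]
    simp only [interaction_ghostConfig, ghostConfig_add]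
    rw [lintegral_add_left (measurable_ghostDoseRate hv X a τ₀ ω)]
  -- the four weights as `if`s
  classical
  have hbath : bathWindowFactor v L X' τ₀ ω = bathWindowFactor v L X τ₀ ω :=
    bathWindowFactor_shiftedStart v L X a τ₀ ω
  have hT : taggedWindowFactor v L X a τ₀ ω = if A then expNeg I₁ else 0 := by
    rw [taggedWindowFactor, Set.indicator_apply]; rfl
  have hBf : bathWindowFactor v L X τ₀ ω = if B then expNeg I₂ else 0 := by
    rw [bathWindowFactor, Set.indicator_apply]; rfl
  have hCf : postFactor v L X' τ₀ t ω = if C then expNeg I₃ else 0 := by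
    rw [postFactor, Set.indicator_apply]; rfl
  have hLHS : rawFKWeight v L ((τ₀ : ℝ) + t) (X, taggedRampShift a τ₀ (brownianPaths ω)) =
      if A ∧ (B ∧ C) then expNeg (I₁ + I₂ + I₃) else 0 := by
    rw [rawFKWeight, Set.indicator_apply]
    by_cases h : A ∧ (B ∧ C)
    · rw [if_pos (hsurv.2 h), if_pos h, hact]
    · rw [if_neg (fun h' => h (hsurv.1 h')), if_neg h]
  -- assemble
  rw [hLHS, phantomWeight, hbath, hT, hBf, hCf]
  by_cases ha : A <;> by_cases hb : B <;> by_cases hc : C <;>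
    simp [ha, hb, hc, expNeg_add, mul_assoc]

/-- No shift: the ramp shift of slope `0` is the identity. [folklore] -/
@[simp] theorem taggedRampShift_zero (τ₀ : ℝ≥0) (w : PathSpace (n + 1)) : taggedRampShift 0 τ₀ w = w := by
  funext i k u
  simp [taggedRampShift]

/-- No shift: the shifted start of slope `0` is the start. [folklore] -/
@[simp] theorem shiftedStart_zero (X : Config (n + 1)) (τ₀ : ℝ≥0) : shiftedStart X 0 τ₀ = X := by
  simp only [shiftedStart, Pi.zero_apply, zero_mul, mul_zero]
  change Function.update X 0 (X 0 + WithLp.toLp 2 (0 : Fin 3 → ℝ)) = X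
  rw [WithLp.toLp_zero, add_zero, Function.update_eq_self]

/-- **The real weight is (tagged window factor) × (phantom weight)** (`a = 0`). [folklore] -/
theorem fkWeight_eq_taggedWindowFactor_mul_phantomWeight {v : ℝ → ℝ≥0∞} (hv : Measurable v) (L : ℝ)
    (X : Config (n + 1)) (τ₀ t : ℝ≥0) (ω : PathSpace (n + 1)) :
    fkWeight v L ((τ₀ : ℝ) + t) X ω = taggedWindowFactor v L X 0 τ₀ ω * phantomWeight v L τ₀ t X ω := by
  have h := rawFKWeight_taggedRampShift_eq hv L X 0 τ₀ t ω
  rw [taggedRampShift_zero, shiftedStart_zero, rawFKWeight_brownianPaths] at h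
  exact h

/-- The tagged window factor is at most `1`. [folklore] -/
theorem taggedWindowFactor_le_one (v : ℝ → ℝ≥0∞) (L : ℝ) (X : Config (n + 1)) (a : Fin 3 → ℝ)
    (τ₀ : ℝ≥0) (ω : PathSpace (n + 1)) : taggedWindowFactor v L X a τ₀ ω ≤ 1 := by
  unfold taggedWindowFactor
  exact Set.indicator_apply_le' (fun _ => expNeg_le_one _) (fun _ => zero_le_one)

/-- **`φ ≤ φ̄`**: the Feynman–Kac functional is dominated by the phantom partition function,
`(e^{-(τ₀+t)H}1)(X) ≤ φ̄(X) := ∫ phantomWeight v L τ₀ t X dW`. [folklore] -/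
theorem fkSemigroup_one_le_phantom {v : ℝ → ℝ≥0∞} (hv : Measurable v) (L : ℝ) (X : Config (n + 1))
    (τ₀ t : ℝ≥0) :
    fkSemigroup v L ((τ₀ : ℝ) + t) (fun _ => (1 : ℝ≥0∞)) X ≤
      ∫⁻ ω, phantomWeight v L τ₀ t X ω ∂wienerPaths (n + 1) := by
  simp only [fkSemigroup, mul_one]
  refine lintegral_mono fun ω => ?_
  rw [fkWeight_eq_taggedWindowFactor_mul_phantomWeight hv L X τ₀ t ω]
  calc taggedWindowFactor v L X 0 τ₀ ω * phantomWeight v L τ₀ t X ω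
      ≤ 1 * phantomWeight v L τ₀ t X ω := mul_le_mul' (taggedWindowFactor_le_one v L X 0 τ₀ ω) le_rfl
    _ = _ := one_mul _

/-- **The phantom-window identity (★), path-integral form.** For every start `X`, slope `a`,
horizon `τ₀`, window `t` and measurable `v`:
`(e^{-(τ₀+t)H}1)(X) = ∫ ℛ · (ghost tagged window factor) · phantomWeight v L τ₀ t (X + √2τ₀ a e₀) dW`,
`ℛ = ∏_k exp(-a_k b_{τ₀} - a_k²τ₀/2)` (`stub_ghostRepresentation` ∘ `stub_phantomFactorisation`).
With `X = (x″ + z) :: Y`, `a = -z/(√2τ₀)`: `X + √2τ₀ a e₀ = x″ :: Y`, i.e.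
`φ_T(x″+z, Y) = E[ℛ_z · L(γ^z) · 𝒲̄_{x″,Y}] = φ̄(x″,Y) · Ē_{x″,Y}[ℛ_z L(γ^z)]` — LeadA1Report §2 (★),
exact for hard cores and Dirichlet walls. [folklore] -/
theorem fkSemigroup_one_eq_lintegral_phantom {v : ℝ → ℝ≥0∞} (hv : Measurable v) (L : ℝ)
    (X : Config (n + 1)) (a : Fin 3 → ℝ) (τ₀ t : ℝ≥0) :
    fkSemigroup v L ((τ₀ : ℝ) + t) (fun _ => (1 : ℝ≥0∞)) X =
      ∫⁻ ω, taggedRampDensity (fun k => -a k) τ₀ ω *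
        (taggedWindowFactor v L X a τ₀ ω * phantomWeight v L τ₀ t (shiftedStart X a τ₀) ω)
        ∂wienerPaths (n + 1) := by
  rw [fkSemigroup_one_eq_lintegral_taggedRampShift hv L ((τ₀ : ℝ) + t) a τ₀ X]
  refine lintegral_congr fun ω => ?_
  rw [rawFKWeight_taggedRampShift_eq hv L X a τ₀ t ω]

/-- Registered toolbox stub `stub_phantomFactorisation` (lead a1): the phantom factorisation of the
ghost weight, all particle numbers, potentials, boxes, starts, slopes, horizons and windows. -/
theorem stub_phantomFactorisation : ∀ (n : ℕ) (v : ℝ → ℝ≥0∞), Measurable v → ∀ (L : ℝ)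
    (X : Config (n + 1)) (a : Fin 3 → ℝ) (τ₀ t : ℝ≥0) (ω : PathSpace (n + 1)),
      rawFKWeight v L ((τ₀ : ℝ) + t) (X, taggedRampShift a τ₀ (brownianPaths ω)) =
        taggedWindowFactor v L X a τ₀ ω * phantomWeight v L τ₀ t (shiftedStart X a τ₀) ω :=
  fun _ _ hv L X a τ₀ t ω => rawFKWeight_taggedRampShift_eq hv L X a τ₀ t ω

end Summit.AtomisticToContinuum.BoseEinsteinCondensation.Cruxes.TwoReplicaTransienceBound.TaggedShiftLogHarnack

end
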